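import Literature.AlgebraicGeometry.ModuliOfAbelianVarieties.SimilitudeRestrictionOfScalars
import Literature.AlgebraicGeometry.ShimuraVarieties.UnitaryAuxiliarySymplecticModule
import HarnessLib

/-!
# The symplectic module `(W₀ ⊕ V_M, ψ)` of the twisted unitary datum IN ANY RANK `n`, and its similitude representation
# `(t, X) ↦ diag(t, t·X)` on `R`-points (Deligne 1979, Prop. 2.3.10 — the group-map carrier, algebraic layer; RSZ 2020 Remark 3.2)

Topic `AlgebraicGeometry/ShimuraVarieties`; namespace `Literature.AlgebraicGeometry.ShimuraVarieties.UnitaryCurve.Aux`.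
Definitions with bodies and theorems; no named fact, no instance, nothing asserted (net debt 0).  Cell `hodgecm-mathlib` (D-0151),
FLOOR 0, P6 «MOD programme», door (E) of `stub_RGD` (LEAD F0P6-plan (g2) «M-17m′» 2026-09-01), organ **E1** (GEN heir A-p18 (g31) memo
`SCOPING-U1-U2.v1` §3): the RANK-`n` form of ★ `UnitaryAuxiliarySymplecticModule` (which is the case `n = 3` of the hDel I-1′ receptacle,
namespace `…UnitaryCanonicalModel.Aux`, kept untouched); the unitary Shimura CURVE of [Liu2021] App. C∕D ∕ [RapoportSmithlingZhang2020Diagonal]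
§3–§4 is the case `n = 2`.  Every declaration below is the ★ rank-3 declaration with `Fin n ↦ Fin n`, SAME NAMES in the new namespace, so that the
E2–E7 organs transcribe the ★ rank-3 consumers by a namespace swap.  `--supports stmt-HodgeConjecture-24832`, count-neutral; HC_CM is proved only
modulo the printed citations until rung 0 closes.

THE OBJECT ([Deligne1979ShimuraVarieties] Prop. 2.3.10; [Milne2005ShimuraVarieties] §8 p. 81; [RapoportSmithlingZhang2020Diagonal] Remark 3.2 (ii)(iii),
pp. 9–10: `Sh(G̃) = Sh(Z^ℚ) ×  Sh(Res_{F₀∕ℚ} G)`, the auxiliary torus keeping the similitude factor rational): the ℚ-symplectic module behind the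
Hodge-type embedding `(Res_{L⁺/ℚ} U(H) × T₀(M), X × {h_Φ}) ↪ (GSp(W₀ ⊕ V_M), S^±)`, `W₀ = M`, `V_M = V ⊗_{L,j} M` (`V = L^n` hermitian for `H`),
acting by `(u, z) ↦ (z, z·u)`, polarised by `Tr_{M/ℚ}(ξ₀ x c(y)) ⊕ Tr_{M/ℚ}(ξ H_M(x,y))`, written with the generic restriction-of-scalars layer
★ `ModuliOfAbelianVarieties.SimilitudeRestrictionOfScalars` on `R`-points for EVERY commutative ℚ-algebra `R`:

* (★ reused: `conjAlgHom M`, `conjR M R = 1 ⊗ c`, `ratBasis`, `trace_one_tmul`); `auxGram M j H ξ₀ ξ = diag(ξ₀, ξ·H^j)` on `M^{1 ⊕ n} = W₀ ⊕ V_M` and `auxGramR`; the form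
  `auxForm = Tr_{M/ℚ}(ᵗc(x)·auxGram·y)` (★ `traceForm` at `R = ℚ`, `S = M`).
* `blockGL S : Sˣ × GL_n(S) →* GL_{1⊕n}(S)`, `(t, X) ↦ diag(t, t·X)`, and `block_form`: `c(t)·t = ν`, `ᵗc(X)·H·X = H` ⇒ `ᵗc(A)·G·A = ν·G`.
* `SymplecticFrame M j H ξ₀ ξ g δ` — a symplectic ℚ-basis of type `δ`: `β : M^{1⊕n} ≃ₗ[ℚ] ℚ^{g ⊕ g}` with `auxForm v w = β(v)·E_δ·β(w)`;
  `frameP`∕`frameQ` (`P Q = 1`, `Q P = 1`), `framePR`∕`frameQR`.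
* **`auxRep β R : (R ⊗_ℚ M)ˣ × GL_n(R ⊗_ℚ M) →* GL_{g⊕g}(R)`** and **`auxRep_mem_similitudeGroupOfForm`** (multiplier `ν = t·c(t)`); ingredients
  `traceGram_baseChange`, `traceGram_eq_frame`, `traceGram_baseChange_eq_frame`, `isMultiplier_auxRep`.

## References
* [Deligne1979ShimuraVarieties] P. Deligne, *Variétés de Shimura* (1979), Prop. 2.3.10 and 2.3.9 (PDF p. 32 of Milne's translation).
* [Milne2005ShimuraVarieties] J. S. Milne, *Introduction to Shimura varieties* (2005), §6 p. 67, §8 p. 81 («ψ = Tr_{B/ℚ}»), Thm. 8.17 p. 88.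
* [RapoportSmithlingZhang2020Diagonal] M. Rapoport, B. Smithling, W. Zhang, *Arithmetic diagonal cycles on unitary Shimura varieties*, Compos. Math. 156
  (2020), Remark 3.2 (ii)(iii) pp. 9–10, Prop. 3.7 pp. 13–14.
* [Liu2021] Y. Liu, App. C Def. C.11 (the similitude torus `T₀`).
-/

set_option autoImplicit false

noncomputable section

open Matrix NumberField
open scoped TensorProduct

namespace Literature.AlgebraicGeometry.ShimuraVarieties

namespace UnitaryCurve

namespace Aux

open Literature.AlgebraicGeometry.ModuliOfAbelianVarieties

/-! ### §1. Complex conjugation of `M` over `ℚ` and on `R ⊗_ℚ M`: ★ rank-free `conjAlgHom`, `conjR`, `ratBasis`, `trace_one_tmul` of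
`UnitaryAuxiliarySymplecticModule` (namespace `…UnitaryCanonicalModel.Aux`) are REUSED, not re-declared. -/

open Literature.AlgebraicGeometry.ShimuraVarieties.UnitaryCanonicalModel.Aux (conjAlgHom conjAlgHom_apply conjR conjR_tmul ratBasis
  trace_one_tmul)

/-! ### §2. The Gram data `diag(ξ₀, ξ·H^j)` and the trace form `ψ` -/

section Gram

variable {L : Type} [Field L] (M : Type) [Field M] [NumberField M] [IsCMField M] (j : L →+* M)
  {n : ℕ} (H : Matrix (Fin n) (Fin n) L) (ξ₀ ξ : M)

/-- **The sesquilinear Gram matrix `diag(ξ₀, ξ·H^j)` on `W₀ ⊕ V_M = M^{1 ⊕ n}`** (`H^j = H.map j` the hermitian form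
extended `M`-sesquilinearly). [cite: Deligne1979ShimuraVarieties, Prop. 2.3.10 (PDF p. 32)] [cite: Milne2005ShimuraVarieties, §8 p. 81] -/
def auxGram : Matrix (Fin 1 ⊕ Fin n) (Fin 1 ⊕ Fin n) M :=
  Matrix.fromBlocks (ξ₀ • (1 : Matrix (Fin 1) (Fin 1) M)) 0 0 (ξ • H.map j)

/-- `auxGram` base-changed to `R ⊗_ℚ M` (entries `1 ⊗ G_{ij}`). [cite: Deligne1979ShimuraVarieties, Prop. 2.3.10 (PDF p. 32)] -/
def auxGramR (R : Type) [CommRing R] [Algebra ℚ R] : Matrix (Fin 1 ⊕ Fin n) (Fin 1 ⊕ Fin n) (R ⊗[ℚ] M) :=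
  (auxGram M j H ξ₀ ξ).map (Algebra.TensorProduct.includeRight : M →ₐ[ℚ] R ⊗[ℚ] M)

omit [IsCMField M] in
/-- Entries of `auxGramR`: `1 ⊗ G_{ij}`. [cite: Deligne1979ShimuraVarieties, Prop. 2.3.10 (PDF p. 32)] -/
@[simp] theorem auxGramR_apply (R : Type) [CommRing R] [Algebra ℚ R] (i i' : Fin 1 ⊕ Fin n) :
    auxGramR M j H ξ₀ ξ R i i' = (1 : R) ⊗ₜ auxGram M j H ξ₀ ξ i i' := rfl

/-- **The symplectic form `ψ((x₀,x),(y₀,y)) = Tr_{M/ℚ}(c(x₀) ξ₀ y₀) + Tr_{M/ℚ}(ξ·ᵗc(x)·H^j·y)`** on `W₀ ⊕ V_M`, as the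
trace form of `auxGram` (★ `traceForm` at `R = ℚ`, `S = M`). [cite: Deligne1979ShimuraVarieties, Prop. 2.3.10 (PDF p. 32)]
[cite: Milne2005ShimuraVarieties, §8 p. 81] -/
def auxForm : LinearMap.BilinForm ℚ ((Fin 1 ⊕ Fin n) → M) :=
  traceForm (R := ℚ) (S := M) (conjAlgHom M) (auxGram M j H ξ₀ ξ)

/-- Unfolding of `auxForm`. [cite: Milne2005ShimuraVarieties, §8 p. 81] -/
theorem auxForm_apply (v w : (Fin 1 ⊕ Fin n) → M) :
    auxForm M j H ξ₀ ξ v w =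
      Algebra.trace ℚ M (dotProduct (fun i => IsCMField.complexConj M (v i)) (auxGram M j H ξ₀ ξ *ᵥ w)) := rfl

end Gram

/-! ### §3. The block embedding `(t, X) ↦ diag(t, t·X)` and the form condition -/

section Block

variable (S : Type) [CommRing S] {n : ℕ}

/-- A multiplicative map pulls a scalar out of an entrywise map: `(r·A).map f = f(r)·A.map f`. [folklore] -/
private theorem map_smul_eq {S' : Type} [CommRing S'] {m n : Type} (f : S → S') (hf : ∀ a b, f (a * b) = f a * f b)
    (r : S) (A : Matrix m n S) : (r • A).map f = f r • A.map f := by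
  ext i k
  simp [hf]

/-- **`(t, X) ↦ diag(t, t·X) : Sˣ × GL_n(S) → GL_{1⊕n}(S)`** — Deligne's `(u, z) ↦ (z, z·u)` on `W₀ ⊕ V_M`
(`z` acts by the scalar `t` on `W₀` and by `t·X` on `V_M`). [cite: Deligne1979ShimuraVarieties, Prop. 2.3.10 (PDF p. 32)] -/
def blockGL : Sˣ × GL (Fin n) S →* GL (Fin 1 ⊕ Fin n) S where
  toFun p :=
    { val := Matrix.fromBlocks ((p.1 : S) • (1 : Matrix (Fin 1) (Fin 1) S)) 0 0 ((p.1 : S) • (p.2 : Matrix (Fin n) (Fin n) S))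
      inv := Matrix.fromBlocks (((p.1⁻¹ : Sˣ) : S) • (1 : Matrix (Fin 1) (Fin 1) S)) 0 0
        (((p.1⁻¹ : Sˣ) : S) • ((p.2⁻¹ : GL (Fin n) S) : Matrix (Fin n) (Fin n) S))
      val_inv := by
        rw [Matrix.fromBlocks_multiply]
        simp [Matrix.mul_smul, smul_smul, Matrix.fromBlocks_one]
      inv_val := by
        rw [Matrix.fromBlocks_multiply]
        simp [Matrix.mul_smul, smul_smul, Matrix.fromBlocks_one] }
  map_one' := by
    ext1
    simp only [Prod.fst_one, Prod.snd_one, Units.val_one, one_smul, Matrix.fromBlocks_one]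
  map_mul' p q := by
    ext1
    change Matrix.fromBlocks (((p.1 * q.1 : Sˣ) : S) • (1 : Matrix (Fin 1) (Fin 1) S)) 0 0
        (((p.1 * q.1 : Sˣ) : S) • ((p.2 * q.2 : GL (Fin n) S) : Matrix (Fin n) (Fin n) S)) =
      Matrix.fromBlocks ((p.1 : S) • (1 : Matrix (Fin 1) (Fin 1) S)) 0 0 ((p.1 : S) • (p.2 : Matrix (Fin n) (Fin n) S)) *
        Matrix.fromBlocks ((q.1 : S) • (1 : Matrix (Fin 1) (Fin 1) S)) 0 0 ((q.1 : S) • (q.2 : Matrix (Fin n) (Fin n) S))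
    rw [Matrix.fromBlocks_multiply]
    simp [Matrix.mul_smul, smul_smul, mul_comm (q.1 : S) (p.1 : S)]

/-- Underlying matrix of `blockGL`. [cite: Deligne1979ShimuraVarieties, Prop. 2.3.10 (PDF p. 32)] -/
@[simp] theorem coe_blockGL (t : Sˣ) (X : GL (Fin n) S) :
    ((blockGL S (t, X) : GL (Fin 1 ⊕ Fin n) S) : Matrix (Fin 1 ⊕ Fin n) (Fin 1 ⊕ Fin n) S) =
      Matrix.fromBlocks ((t : S) • (1 : Matrix (Fin 1) (Fin 1) S)) 0 0 ((t : S) • (X : Matrix (Fin n) (Fin n) S)) := rfl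

/-- `ᵗc(diag(t, t·X)) = diag(c(t), c(t)·ᵗc(X))`. [cite: Deligne1979ShimuraVarieties, Prop. 2.3.10 (PDF p. 32)] -/
theorem transpose_map_coe_blockGL {S' : Type} [CommRing S'] (f : S →+* S') (t : Sˣ) (X : GL (Fin n) S) :
    ((((blockGL S (t, X) : GL (Fin 1 ⊕ Fin n) S) : Matrix (Fin 1 ⊕ Fin n) (Fin 1 ⊕ Fin n) S).map f)ᵀ) =
      Matrix.fromBlocks (f t • (1 : Matrix (Fin 1) (Fin 1) S')) 0 0 (f t • ((X : Matrix (Fin n) (Fin n) S).map f)ᵀ) := by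
  rw [coe_blockGL, Matrix.fromBlocks_map, Matrix.fromBlocks_transpose, map_smul_eq S f (map_mul f),
    map_smul_eq S f (map_mul f), Matrix.map_one f (map_zero f) (map_one f), Matrix.map_zero f (map_zero f),
    Matrix.map_zero f (map_zero f), Matrix.transpose_smul, Matrix.transpose_smul, Matrix.transpose_one,
    Matrix.transpose_zero, Matrix.transpose_zero]

/-- **The form condition for `diag(t, t·X)`**: if `c(t)·t = ν` (similitude torus) and `ᵗc(X)·H·X = H` (`X` unitary
for `H`, the tree's ★ `unitaryGroupOfForm` convention) then `A = diag(t, t·X)` satisfies `ᵗc(A)·G·A = ν·G` for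
`G = diag(ξ₀·1, ξ·H)`. [cite: Deligne1979ShimuraVarieties, Prop. 2.3.10 (PDF p. 32)] [cite: Milne2005ShimuraVarieties, §8 p. 81] -/
theorem block_form {R : Type} [CommRing R] [Algebra R S] (c : S →ₐ[R] S) (Hs : Matrix (Fin n) (Fin n) S)
    (ξ₀s ξs : S) {t : Sˣ} {X : GL (Fin n) S} {ν : R} (ht : c (t : S) * (t : S) = algebraMap R S ν)
    (hX : ((X : Matrix (Fin n) (Fin n) S).map c)ᵀ * Hs * (X : Matrix (Fin n) (Fin n) S) = Hs) :
    (((blockGL S (t, X) : GL (Fin 1 ⊕ Fin n) S) : Matrix (Fin 1 ⊕ Fin n) (Fin 1 ⊕ Fin n) S).map c)ᵀ *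
        Matrix.fromBlocks (ξ₀s • (1 : Matrix (Fin 1) (Fin 1) S)) 0 0 (ξs • Hs) *
        ((blockGL S (t, X) : GL (Fin 1 ⊕ Fin n) S) : Matrix (Fin 1 ⊕ Fin n) (Fin 1 ⊕ Fin n) S) =
      algebraMap R S ν • Matrix.fromBlocks (ξ₀s • (1 : Matrix (Fin 1) (Fin 1) S)) 0 0 (ξs • Hs) := by
  have hT := transpose_map_coe_blockGL S (c : S →+* S) t X
  simp only [RingHom.coe_coe] at hT
  rw [hT, coe_blockGL, Matrix.fromBlocks_multiply, Matrix.fromBlocks_multiply, Matrix.fromBlocks_smul]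
  simp only [Matrix.zero_mul, Matrix.mul_zero, add_zero, zero_add, smul_zero, Matrix.smul_mul, Matrix.mul_smul,
    smul_smul, Matrix.mul_one]
  rw [hX, Matrix.fromBlocks_inj]
  refine ⟨?_, rfl, rfl, ?_⟩
  · congr 1
    rw [← ht]; ring
  · congr 1
    rw [← ht]; ring

end Block

/-! ### §4. Symplectic frames of type `δ` and the representation on `R`-points -/

section Frame

variable {L : Type} [Field L] (M : Type) [Field M] [NumberField M] [IsCMField M] (j : L →+* M)
  {n : ℕ} (H : Matrix (Fin n) (Fin n) L) (ξ₀ ξ : M) (g : ℕ) (δ : Fin g → ℕ)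

/-- **A symplectic frame of type `δ` for `(W₀ ⊕ V_M, ψ)`**: a `ℚ`-linear isomorphism `β : M^{1⊕n} ≃ ℚ^{g⊕g}` carrying
`ψ` to the standard alternating form `E_δ` of type `δ` (★ `typeFormOver δ ℚ`); the lattice of the moduli problem is
`β⁻¹(ℤ^{2g})`.  The type `δ` and the frame are data (planner ruling R-d: nothing hard-coded; `g = 2[M:ℚ]` is forced
by the existence of `β`). [cite: Deligne1979ShimuraVarieties, Prop. 2.3.10 (PDF p. 32)] [cite: Milne2005ShimuraVarieties, §6 p. 67] -/
structure SymplecticFrame where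
  /-- the symplectic coordinates. -/
  β : ((Fin 1 ⊕ Fin n) → M) ≃ₗ[ℚ] (Fin g ⊕ Fin g → ℚ)
  /-- `ψ(v, w) = ᵗβ(v)·E_δ·β(w)`. -/
  gram : ∀ v w, auxForm M j H ξ₀ ξ v w = β v ⬝ᵥ (typeFormOver δ ℚ *ᵥ β w)

variable {M j H ξ₀ ξ g δ}

/-- The frame matrix `P`: columns = symplectic coordinates of the `M`-adapted basis vectors `eᵢ b_k`.
[cite: Deligne1979ShimuraVarieties, Prop. 2.3.10 (PDF p. 32)] -/
def frameP (F : SymplecticFrame M j H ξ₀ ξ g δ) :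
    Matrix (Fin g ⊕ Fin g) ((Fin 1 ⊕ Fin n) × Fin (Module.finrank ℚ M)) ℚ :=
  LinearMap.toMatrix (resBasis (m := Fin 1 ⊕ Fin n) (ratBasis M)) (Pi.basisFun ℚ (Fin g ⊕ Fin g)) F.β.toLinearMap

/-- The inverse frame matrix `Q`. [cite: Deligne1979ShimuraVarieties, Prop. 2.3.10 (PDF p. 32)] -/
def frameQ (F : SymplecticFrame M j H ξ₀ ξ g δ) :
    Matrix ((Fin 1 ⊕ Fin n) × Fin (Module.finrank ℚ M)) (Fin g ⊕ Fin g) ℚ :=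
  LinearMap.toMatrix (Pi.basisFun ℚ (Fin g ⊕ Fin g)) (resBasis (m := Fin 1 ⊕ Fin n) (ratBasis M)) F.β.symm.toLinearMap

/-- `P Q = 1`. [cite: Deligne1979ShimuraVarieties, Prop. 2.3.10 (PDF p. 32)] -/
theorem frameP_mul_frameQ (F : SymplecticFrame M j H ξ₀ ξ g δ) : frameP F * frameQ F = 1 := by
  rw [frameP, frameQ, ← LinearMap.toMatrix_comp]
  have h : F.β.toLinearMap ∘ₗ F.β.symm.toLinearMap = LinearMap.id := LinearMap.ext fun x => F.β.apply_symm_apply x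
  rw [h, LinearMap.toMatrix_id]

/-- `Q P = 1`. [cite: Deligne1979ShimuraVarieties, Prop. 2.3.10 (PDF p. 32)] -/
theorem frameQ_mul_frameP (F : SymplecticFrame M j H ξ₀ ξ g δ) : frameQ F * frameP F = 1 := by
  rw [frameP, frameQ, ← LinearMap.toMatrix_comp]
  have h : F.β.symm.toLinearMap ∘ₗ F.β.toLinearMap = LinearMap.id := LinearMap.ext fun x => F.β.symm_apply_apply x
  rw [h, LinearMap.toMatrix_id]

/-- Entries of `P`: `P a (i,k) = β(eᵢ b_k) a`. [cite: Deligne1979ShimuraVarieties, Prop. 2.3.10 (PDF p. 32)] -/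
theorem frameP_apply (F : SymplecticFrame M j H ξ₀ ξ g δ) (a : Fin g ⊕ Fin g)
    (p : (Fin 1 ⊕ Fin n) × Fin (Module.finrank ℚ M)) :
    frameP F a p = F.β (resBasis (m := Fin 1 ⊕ Fin n) (ratBasis M) p) a := by
  rw [frameP, LinearMap.toMatrix_apply, Pi.basisFun_repr]
  rfl

variable (R : Type) [CommRing R] [Algebra ℚ R]

/-- `P` over `R`. [cite: Deligne1979ShimuraVarieties, Prop. 2.3.10 (PDF p. 32)] -/
def framePR (F : SymplecticFrame M j H ξ₀ ξ g δ) : Matrix (Fin g ⊕ Fin g) ((Fin 1 ⊕ Fin n) × Fin (Module.finrank ℚ M)) R :=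
  (frameP F).map (algebraMap ℚ R)

/-- `Q` over `R`. [cite: Deligne1979ShimuraVarieties, Prop. 2.3.10 (PDF p. 32)] -/
def frameQR (F : SymplecticFrame M j H ξ₀ ξ g δ) : Matrix ((Fin 1 ⊕ Fin n) × Fin (Module.finrank ℚ M)) (Fin g ⊕ Fin g) R :=
  (frameQ F).map (algebraMap ℚ R)

/-- `P_R Q_R = 1`. [cite: Deligne1979ShimuraVarieties, Prop. 2.3.10 (PDF p. 32)] -/
theorem framePR_mul_frameQR (F : SymplecticFrame M j H ξ₀ ξ g δ) : framePR R F * frameQR R F = 1 := by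
  rw [framePR, frameQR, ← Matrix.map_mul, frameP_mul_frameQ, Matrix.map_one _ (map_zero _) (map_one _)]

/-- `Q_R P_R = 1`. [cite: Deligne1979ShimuraVarieties, Prop. 2.3.10 (PDF p. 32)] -/
theorem frameQR_mul_framePR (F : SymplecticFrame M j H ξ₀ ξ g δ) : frameQR R F * framePR R F = 1 := by
  rw [framePR, frameQR, ← Matrix.map_mul, frameQ_mul_frameP, Matrix.map_one _ (map_zero _) (map_one _)]

/-- **The similitude representation on `R`-points `(R ⊗_ℚ M)ˣ × GL_n(R ⊗_ℚ M) → GL_{g⊕g}(R)`**: the block embedding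
`diag(t, t·X)`, restriction of scalars along the `R`-basis `1 ⊗ b_k` of `R ⊗_ℚ M`, read in the symplectic frame.
[cite: Deligne1979ShimuraVarieties, Prop. 2.3.10 (PDF p. 32)] [cite: Milne2005ShimuraVarieties, §8 p. 81] -/
def auxRep (F : SymplecticFrame M j H ξ₀ ξ g δ) : (R ⊗[ℚ] M)ˣ × GL (Fin n) (R ⊗[ℚ] M) →* GL (Fin g ⊕ Fin g) R :=
  (conjRect (framePR R F) (frameQR R F) (framePR_mul_frameQR R F) (frameQR_mul_framePR R F)).comp
    ((resGL (m := Fin 1 ⊕ Fin n) (Algebra.TensorProduct.basis R (ratBasis M))).comp (blockGL (R ⊗[ℚ] M)))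

/-! #### Trace and Gram matrix under base change -/

/-- **The Gram matrix of `ψ_R` in the basis `eᵢ ⊗ (1 ⊗ b_k)` is the base change of the Gram matrix of `ψ`.**
[cite: Milne2005ShimuraVarieties, §8 p. 81] -/
theorem traceGram_baseChange :
    traceGram (m := Fin 1 ⊕ Fin n) (conjR M R) (auxGramR M j H ξ₀ ξ R) (Algebra.TensorProduct.basis R (ratBasis M)) =
      (traceGram (m := Fin 1 ⊕ Fin n) (conjAlgHom M) (auxGram M j H ξ₀ ξ) (ratBasis M)).map (algebraMap ℚ R) := by
  ext p q
  rw [Matrix.map_apply, traceGram_apply, traceGram_apply, Algebra.TensorProduct.basis_apply,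
    Algebra.TensorProduct.basis_apply, conjR_tmul, auxGramR_apply, Algebra.TensorProduct.tmul_mul_tmul,
    Algebra.TensorProduct.tmul_mul_tmul, one_mul, one_mul, trace_one_tmul, conjAlgHom_apply]

/-- `ᵗP·E·P` entrywise as a double contraction of columns. [folklore] -/
private theorem transpose_mul_mul_apply {n n' : Type} [Fintype n] [Fintype n'] {A : Type} [CommRing A]
    (P : Matrix n n' A) (E : Matrix n n A) (p q : n') :
    (Pᵀ * E * P) p q = (fun a => P a p) ⬝ᵥ (E *ᵥ fun b => P b q) := by
  simp only [Matrix.mul_apply, Matrix.transpose_apply, dotProduct, Matrix.mulVec, Finset.sum_mul, Finset.mul_sum,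
    mul_assoc]
  exact Finset.sum_comm

/-- **The Gram matrix of `ψ` in the `M`-adapted basis is `ᵗP·E_δ·P`** (the frame condition read on basis vectors).
[cite: Deligne1979ShimuraVarieties, Prop. 2.3.10 (PDF p. 32)] -/
theorem traceGram_eq_frame (F : SymplecticFrame M j H ξ₀ ξ g δ) :
    traceGram (m := Fin 1 ⊕ Fin n) (conjAlgHom M) (auxGram M j H ξ₀ ξ) (ratBasis M) =
      (frameP F)ᵀ * typeFormOver δ ℚ * frameP F := by
  ext p q
  rw [transpose_mul_mul_apply, traceGram, LinearMap.BilinForm.toMatrix_apply]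
  change auxForm M j H ξ₀ ξ _ _ = _
  rw [F.gram]
  congr 1
  · funext a; rw [frameP_apply]
  · congr 1; funext b; rw [frameP_apply]

/-- The Gram matrix of `ψ_R` is `ᵗP_R·E_δ·P_R`. [cite: Deligne1979ShimuraVarieties, Prop. 2.3.10 (PDF p. 32)] -/
theorem traceGram_baseChange_eq_frame (F : SymplecticFrame M j H ξ₀ ξ g δ) :
    traceGram (m := Fin 1 ⊕ Fin n) (conjR M R) (auxGramR M j H ξ₀ ξ R) (Algebra.TensorProduct.basis R (ratBasis M)) =
      (framePR R F)ᵀ * typeFormOver δ R * framePR R F := by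
  rw [traceGram_baseChange, traceGram_eq_frame F, Matrix.map_mul, Matrix.map_mul, Matrix.transpose_map,
    typeFormOver_map]
  rfl

/-- **`auxRep` lands in `GSp_δ(R)`**: for `t ∈ (R ⊗ M)ˣ` with `c(t)·t = ν ∈ Rˣ` (the similitude torus `T₀`) and
`X ∈ GL_n(R ⊗ M)` unitary for `H^j` (`ᵗc(X)·H^j·X = H^j`), `auxRep β R (t, X)` is a symplectic similitude of `E_δ`
with multiplier `ν`. [cite: Deligne1979ShimuraVarieties, Prop. 2.3.10 (PDF p. 32)] [cite: Milne2005ShimuraVarieties, §6 p. 67, §8 p. 81] -/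
theorem isMultiplier_auxRep (F : SymplecticFrame M j H ξ₀ ξ g δ) {t : (R ⊗[ℚ] M)ˣ} {X : GL (Fin n) (R ⊗[ℚ] M)}
    {ν : Rˣ} (ht : conjR M R (t : R ⊗[ℚ] M) * (t : R ⊗[ℚ] M) = algebraMap R (R ⊗[ℚ] M) (ν : R))
    (hX : ((X : Matrix (Fin n) (Fin n) (R ⊗[ℚ] M)).map (conjR M R))ᵀ *
        (H.map j).map (Algebra.TensorProduct.includeRight : M →ₐ[ℚ] R ⊗[ℚ] M) * (X : Matrix (Fin n) (Fin n) (R ⊗[ℚ] M)) =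
      (H.map j).map (Algebra.TensorProduct.includeRight : M →ₐ[ℚ] R ⊗[ℚ] M)) :
    IsMultiplier (typeFormOver δ R) (auxRep R F (t, X)) ν := by
  have hG : auxGramR M j H ξ₀ ξ R = Matrix.fromBlocks (((1 : R) ⊗ₜ[ℚ] ξ₀) • (1 : Matrix (Fin 1) (Fin 1) (R ⊗[ℚ] M))) 0 0
      (((1 : R) ⊗ₜ[ℚ] ξ) • (H.map j).map (Algebra.TensorProduct.includeRight : M →ₐ[ℚ] R ⊗[ℚ] M)) := by
    rw [auxGramR, auxGram, Matrix.fromBlocks_map,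
      map_smul_eq M (Algebra.TensorProduct.includeRight : M →ₐ[ℚ] R ⊗[ℚ] M) (map_mul _),
      map_smul_eq M (Algebra.TensorProduct.includeRight : M →ₐ[ℚ] R ⊗[ℚ] M) (map_mul _),
      Matrix.map_one _ (map_zero _) (map_one _), Matrix.map_zero _ (map_zero _), Matrix.map_zero _ (map_zero _)]
    rfl
  have hform := block_form (R ⊗[ℚ] M) (conjR M R)
    ((H.map j).map (Algebra.TensorProduct.includeRight : M →ₐ[ℚ] R ⊗[ℚ] M)) ((1 : R) ⊗ₜ ξ₀) ((1 : R) ⊗ₜ ξ) ht hX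
  rw [← hG] at hform
  have hres := isMultiplier_resGL (m := Fin 1 ⊕ Fin n) (conjR M R) (auxGramR M j H ξ₀ ξ R)
    (Algebra.TensorProduct.basis R (ratBasis M)) (A := blockGL (R ⊗[ℚ] M) (t, X)) (ν := ν) hform
  rw [traceGram_baseChange_eq_frame R F] at hres
  exact isMultiplier_conjRect (framePR R F) (frameQR R F) (framePR_mul_frameQR R F) (frameQR_mul_framePR R F) hres

/-- `auxRep β R (t, X) ∈ GSp_δ(R)` under the torus and unitary conditions. [cite: Deligne1979ShimuraVarieties, Prop. 2.3.10 (PDF p. 32)] -/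
theorem auxRep_mem_similitudeGroupOfForm (F : SymplecticFrame M j H ξ₀ ξ g δ) {t : (R ⊗[ℚ] M)ˣ}
    {X : GL (Fin n) (R ⊗[ℚ] M)}
    (ht : ∃ ν : Rˣ, conjR M R (t : R ⊗[ℚ] M) * (t : R ⊗[ℚ] M) = algebraMap R (R ⊗[ℚ] M) (ν : R))
    (hX : ((X : Matrix (Fin n) (Fin n) (R ⊗[ℚ] M)).map (conjR M R))ᵀ *
        (H.map j).map (Algebra.TensorProduct.includeRight : M →ₐ[ℚ] R ⊗[ℚ] M) * (X : Matrix (Fin n) (Fin n) (R ⊗[ℚ] M)) =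
      (H.map j).map (Algebra.TensorProduct.includeRight : M →ₐ[ℚ] R ⊗[ℚ] M)) :
    auxRep R F (t, X) ∈ similitudeGroupOfForm (typeFormOver δ R) := by
  obtain ⟨ν, hν⟩ := ht
  exact ⟨ν, isMultiplier_auxRep R F hν hX⟩

end Frame

end Aux

end UnitaryCurve

end Literature.AlgebraicGeometry.ShimuraVarieties

end
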